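import Literature.MathematicalPhysics.QuantumFieldTheory.Balaban1983to89.B9Eq3132NuReadingR

/-!
# `Balaban1983to89.B9Eq3132NuReadingRJ` — [B9] (3.132) p. 422 under Theorem 3.12's prefix p. 423: THE ROW-26 READINGS OF `B9Eq3132ScalarIndex` §4 AND
# `B9Eq3132NuReadingR` §1 ALONG A SUB-FAMILY `f : J → MemberY …` (the restriction faces a J-indexed consumer needs; nothing new is proved)

T. Bałaban, *Propagators for lattice gauge theories in a background field*, Commun. Math. Phys. **99** (1985) 389–434 [`Balaban1985BackgroundPropagators`], (3.132)
p. 422, Thm 3.12 p. 423 (prefix), (3.35)–(3.36) p. 396; [4] = T. Bałaban, *Propagators and renormalization transformations for lattice gauge theories. II*, Commun.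
Math. Phys. **96** (1984) 223–250 [`Balaban1984PropagatorsII`], Lemma 2.1 (2.60)–(2.61) p. 234, (2.81) p. 237, Prop. 2.7 (2.149) p. 249.

statement-level companion of published sources with citation tags; every declaration here is a theorem; nothing here is a claim about the
Yang–Mills mass gap

WHY THIS FILE (cell `pub-ymgap`, seat `dag-n06-l` g41, 2026-08-31; sibling of dag-n06-i's `B9Eq3132ScalarIndex` §4 ∕ `B9Eq3132NuReadingR` §1, both untouched).
The Combes–Thomas pipeline behind ROW 26 is index-generic (`B9Eq3132ScalarIndex.stmt3132Printed_of_coercive_idx`, `B9Eq3132CTInputs`): any index type `I`, any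
`geo : I → Geometry`, `bg : I → Backgrounds`.  Its two RECORD faces, however, are typed at the full member family — `…ScalarIndex.stmt3132Printed_geo9Y_of_coercive_decay_idx`
(`bg : MemberY … → Backgrounds`, the geometry `geo9Y`) and `…NuReadingR.stmt3132Printed_nu_of_coercive_decay_R` (the carrier `bg9YR 𝔸 G R₁ R₂` over all members) —
because the member facts they discharge (`rowSum261_geo9Y` = [4] (2.61), `hwt_symm_geo9Y` = the weights transfer at `A = L^{|(d′−2)∕2|}`) are stated as ∃-uniform rows over
`MemberY`.  A consumer whose `CoerciveUnder ∕ DecayUnder` inputs live on a SUB-FAMILY `j ↦ f j` only (IR-N06-SECTION-2 road R1, ★★★ director-ym №524 (3): the N06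
producer cone re-keyed along `f : J → MemberY …`, dag-n06-d `R1-JTWIN-SPEC.md`; here: the J-twins of N06's (3.137) prechain `…D2SupPrechainV2AtPinsPUWQ` and of the
row-26 knit reader `…Eq3132FromStateKnitQ`, by-name staging dag-n06-d g30 → dag-n06-l) needs the same two faces at `geo := fun j => geo9Y (f j)`.  THIS FILE gives them:
* §1 the two member facts RESTRICTED along `f` (one-liners: an ∃-uniform row over all members restricts to any sub-family): `rowSum261_geo9Y_comp`,
  `hwt_symm_geo9Y_comp`;
* §2 ★ `stmt3132Printed_geo9Y_of_coercive_decay_idx_J` — `…ScalarIndex` §4 along `f` (same proof text, the two member facts replaced by §1);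
* §3 ★ `stmt3132Printed_nu_of_coercive_decay_R_J` — `…NuReadingR` §1 along `f`: the letter families `T T₁` stay member-wide (read at `f j`), the four Λ-normalised
  binders `hco hdec hco₁ hdec₁` are the index-generic predicates at `I := J`, the conclusion is `B9.Stmt3132Printed dd c35 (fun j => geo9Y (f j)) (fun j => bg9YR 𝔸 G R₁ R₂ (f j)) …`.
The member-wide parents are the instances `J := MemberY …`, `f := id` (nothing is lost).
HONEST SCOPE.  Kernel bookkeeping BY NAME over the index-generic pipeline and the two member facts; (3.132) is NOT proved here beyond what the parents prove
(hypotheses in, printed leaf out); count-neutral; N06 NOT discharged; one finite 𝕋^{d+1} programme — nothing continuum ∕ ℝ⁴ ∕ OS ∕ mass gap ∕ Clay.  No `sorry`,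
no `def`, no `instance`, no `notation`.  Relatives not restated: the parents (these are their restrictions along `f`, not copies).
-/

noncomputable section

namespace Literature.MathematicalPhysics.QuantumFieldTheory.Balaban1983to89.B9Eq3132NuReadingRJ

open Node00
open B6KLevelCensusIndexV1 (KIdx)
open B9PinMembersKLevelV1 (MemberY geo9Y bg9Y)
open B9BackgroundsKLevelV1R (RegFamY bg9YR)
open B9Eq3132CTInputs (CoerciveUnder DecayUnder ctInputs_of_coercive_decay)
open B9Eq3132ScalarIndex (geoComap InvNormalisedIdx rowSum261_geoComap stmt3132Printed_of_coercive_idx)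
open B9Eq3132RingInverseReading (normMatY)
open B9Eq3132NuReading (siteKernelOfOpNu nuY nuY_pos nuY_mul_lamInvY lamInvY lamInvY_pos invNormalisedIdx_nu_of_ringInverse)
open B9Eq3132Whole (WeightsTransfer)
open B9Ineq349Whole (RowSum261)
open B9GeoLemma21KLevelV1 (rowSum261_geo9Y geo9Y_dist_comm geo9K_dist_nonneg' geo9Y_dist_self geo9Y_dist_triangle geo9Y_len_pos hwt_symm_geo9Y symmA_pos)
open scoped Matrix.Norms.L2Operator

variable {d ℓ : ℕ} {hd : 1 ≤ d + 1} {hL : Odd (ℓ + 1) ∧ 1 < ℓ + 1} {b₀ b₁ : ℝ} {Mstar : ℕ}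

/-! ## §1 The two member facts restricted along a sub-family -/

section MemberFacts

variable [∀ x : MemberY d ℓ hd hL b₀ b₁ Mstar, Fintype (geo9Y x).Site] {J : Type} (f : J → MemberY d ℓ hd hL b₀ b₁ Mstar)

/-- [4] (2.61) along a sub-family: the ∃-uniform row sums of `rowSum261_geo9Y` restrict to `j ↦ geo9Y (f j)`. [cite: Balaban1984PropagatorsII, Lemma 2.1 (2.61) p.234] -/
theorem rowSum261_geo9Y_comp : RowSum261 (fun j : J => geo9Y (f j)) := fun κ hκ => by
  obtain ⟨ML, c, h⟩ := rowSum261_geo9Y (d := d) (ℓ := ℓ) (hd := hd) (hL := hL) (b₀ := b₀) (b₁ := b₁) (Mstar := Mstar) κ hκ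
  exact ⟨ML, c, fun j hM y => h (f j) hM y⟩

omit [∀ x : MemberY d ℓ hd hL b₀ b₁ Mstar, Fintype (geo9Y x).Site] in
/-- the weights transfer at `A = L^{|(d′−2)∕2|}` (`hwt_symm_geo9Y`) along a sub-family. [cite: Balaban1984PropagatorsII, Lemma 2.1 (2.60) p.234; Balaban1985BackgroundPropagators, (3.132) p.422] -/
theorem hwt_symm_geo9Y_comp (dd : ℕ) :
    ∀ ε : ℝ, 0 < ε → ∃ Mw : ℝ, ∀ j : J, Mw ≤ (geo9Y (f j)).M →
      WeightsTransfer (geo9Y (f j)) dd (fun y => (geo9Y (f j)).len y ^ (-(1 + (dd : ℝ) / 2))) ε ((((ℓ + 1 : ℕ) : ℝ)) ^ |((dd : ℝ) - 2) / 2|) ∧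
        WeightsTransfer (geo9Y (f j)) dd (fun y => (geo9Y (f j)).len y ^ (-(1 + (dd : ℝ) / 2))) ε ((((ℓ + 1 : ℕ) : ℝ)) ^ |((dd : ℝ) - 2) / 2|) :=
  fun ε hε => by
    obtain ⟨Mw, h⟩ := hwt_symm_geo9Y (d := d) (ℓ := ℓ) (hd := hd) (hL := hL) (b₀ := b₀) (b₁ := b₁) (Mstar := Mstar) dd ε hε
    exact ⟨Mw, fun j hM => h (f j) hM⟩

end MemberFacts

/-! ## §2 ★ Row 26 at the record geometry along a sub-family, matrix-valued kernels (`…ScalarIndex` §4 along `f`) -/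

section Record

variable {J : Type} (f : J → MemberY d ℓ hd hL b₀ b₁ Mstar)

/-- ★ **`B9Eq3132ScalarIndex.stmt3132Printed_geo9Y_of_coercive_decay_idx` ALONG `f : J → MemberY …`**: over the sub-family `j ↦ geo9Y (f j)` (ANY backgrounds
`bg : J → Backgrounds`, `c35`, kernels, ANY finite index `nn j` fibred over the coarse sites by `π j` with fibres ≦ F), `CoerciveUnder` and `DecayUnder` for the
normalised matrices `S`, `S₁` ON THE INDEX and the blockwise dictionaries `InvNormalisedIdx` ×2 give `B9.Stmt3132Printed d′ c35 (fun j => geo9Y (f j)) bg QGQinv QG₁Qinv`.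
Same proof as the parent; the member facts enter through §1. [cite: Balaban1985BackgroundPropagators, (3.132) p.422 + Thm 3.12 p.423 (prefix); Balaban1984PropagatorsII, Lemma 2.1 (2.60)–(2.61) p.234] -/
theorem stmt3132Printed_geo9Y_of_coercive_decay_idx_J (dd : ℕ) [∀ x : MemberY d ℓ hd hL b₀ b₁ Mstar, Fintype (geo9Y x).Site]
    [∀ x : MemberY d ℓ hd hL b₀ b₁ Mstar, DecidableEq (geo9Y x).Site] {c35 : ℝ}
    {bg : J → B9.Backgrounds}
    {QGQinv QG₁Qinv : ∀ j : J, B9.SiteKernel (geo9Y (f j)) (bg j)}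
    {nn : J → Type} [∀ j, Fintype (nn j)] [∀ j, DecidableEq (nn j)]
    (π : ∀ j : J, nn j → (geo9Y (f j)).Site) {F : ℝ}
    (hF : ∀ (j : J) (y : (geo9Y (f j)).Site),
      (((Finset.univ.filter fun a : nn j => π j a = y).card : ℕ) : ℝ) ≤ F)
    {S S₁ : ∀ j : J, (bg j).Cfg → Matrix (nn j) (nn j) ℝ}
    (hco : CoerciveUnder c35 (fun j => geoComap (geo9Y (f j)) (π j)) bg S)
    (hdec : DecayUnder c35 (fun j => geoComap (geo9Y (f j)) (π j)) bg S)
    (hco₁ : CoerciveUnder c35 (fun j => geoComap (geo9Y (f j)) (π j)) bg S₁)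
    (hdec₁ : DecayUnder c35 (fun j => geoComap (geo9Y (f j)) (π j)) bg S₁)
    (hN : ∀ j : J,
      InvNormalisedIdx (QGQinv j) (π j) (S j) (fun y => (geo9Y (f j)).len y ^ (-(1 + (dd : ℝ) / 2))))
    (hN₁ : ∀ j : J,
      InvNormalisedIdx (QG₁Qinv j) (π j) (S₁ j) (fun y => (geo9Y (f j)).len y ^ (-(1 + (dd : ℝ) / 2)))) :
    B9.Stmt3132Printed dd c35 (fun j : J => geo9Y (f j)) bg QGQinv QG₁Qinv := by
  have hdist : ∀ (j : J) (a b : nn j),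
      0 ≤ (geoComap (geo9Y (f j)) (π j)).dist a b := fun j a b => geo9K_dist_nonneg' (f j).toKIdx (π j a) (π j b)
  have hsymm : ∀ (j : J) (a b : nn j),
      (geoComap (geo9Y (f j)) (π j)).dist a b = (geoComap (geo9Y (f j)) (π j)).dist b a :=
    fun j a b => geo9Y_dist_comm (f j) (π j a) (π j b)
  have h261 : RowSum261 (fun j : J => geoComap (geo9Y (f j)) (π j)) :=
    rowSum261_geoComap (geo := fun j : J => geo9Y (f j)) π hF (rowSum261_geo9Y_comp f)
  exact stmt3132Printed_of_coercive_idx dd π hF (ctInputs_of_coercive_decay hdist hsymm h261 hco hdec)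
    (ctInputs_of_coercive_decay hdist hsymm h261 hco₁ hdec₁) hN hN₁ (fun j y y' => geo9Y_dist_comm (f j) y y')
    (fun j y => geo9Y_dist_self (f j) y) (fun j a b c => geo9Y_dist_triangle (f j) a b c) (fun j y => (geo9Y_len_pos (f j) y).le)
    (symmA_pos (ℓ := ℓ) dd) (hwt_symm_geo9Y_comp f dd)

end Record

/-! ## §3 ★ Row 26 for the `ν`-readings at the class-parametric carrier along a sub-family (`…NuReadingR` §1 along `f`) -/

section Row26

variable {𝔸 : Type} [NormedRing 𝔸] [NormedAlgebra ℂ 𝔸] [CompleteSpace 𝔸]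
variable (G : Subgroup 𝔸ˣ) (R₁ R₂ : RegFamY d ℓ hd hL b₀ b₁ Mstar 𝔸) {Ff : Type} [Fintype Ff] [DecidableEq Ff] (b : Module.Basis Ff ℝ 𝔸)
variable {J : Type} (f : J → MemberY d ℓ hd hL b₀ b₁ Mstar)

omit [DecidableEq Ff] in
/-- the fibres of `Prod.fst` have `card Ff` elements. [folklore] -/
private theorem card_fiber_fst {X : Type} [Fintype X] [DecidableEq X] (y : X) :
    (Finset.univ.filter fun a : X × Ff => a.1 = y).card = Fintype.card Ff := by
  rw [show (Finset.univ.filter fun a : X × Ff => a.1 = y) = ({y} : Finset X) ×ˢ (Finset.univ : Finset Ff) by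
    ext ⟨a, f⟩
    simp [eq_comm]]
  simp

/-- ★ **`B9Eq3132NuReadingR.stmt3132Printed_nu_of_coercive_decay_R` ALONG `f : J → MemberY …`**: ROW 26 (`B9.Stmt3132Printed`) for the `ν`-readings of two
ring-inverse letters at the class-parametric carrier restricted to the sub-family, `j ↦ bg9YR 𝔸 G R₁ R₂ (f j)`, from the four Λ-normalised binders ON THE SUB-FAMILY
(the index-generic `CoerciveUnder ∕ DecayUnder` at `I := J`); the letter families `T T₁` stay member-wide and are read at `f j`.  Same proof as the parent, §2 in
place of `…ScalarIndex` §4. [cite: Balaban1985BackgroundPropagators, (3.132) p.422, Thm 3.12 p.423 (prefix), (3.35)–(3.36) p.396; Balaban1984PropagatorsII, (2.81) p.237, Prop. 2.7 (2.149) p.249, Lemma 2.1 (2.60)–(2.61) p.234] -/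
theorem stmt3132Printed_nu_of_coercive_decay_R_J (dd : ℕ) [∀ x : MemberY d ℓ hd hL b₀ b₁ Mstar, Fintype (geo9Y x).Site]
    [∀ x : MemberY d ℓ hd hL b₀ b₁ Mstar, DecidableEq (geo9Y x).Site] {c35 : ℝ}
    (T T₁ : ∀ x : MemberY d ℓ hd hL b₀ b₁ Mstar, CfgY 𝔸 x.toKIdx → Module.End ℂ ((geo9Y x).Site → 𝔸))
    (hco : CoerciveUnder c35 (fun j : J => geoComap (geo9Y (f j)) (Prod.fst : (geo9Y (f j)).Site × Ff → (geo9Y (f j)).Site))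
      (fun j : J => bg9YR 𝔸 G R₁ R₂ (f j)) (fun j U => normMatY b (lamInvY (f j).toKIdx) (T (f j) U)))
    (hdec : DecayUnder c35 (fun j : J => geoComap (geo9Y (f j)) (Prod.fst : (geo9Y (f j)).Site × Ff → (geo9Y (f j)).Site))
      (fun j : J => bg9YR 𝔸 G R₁ R₂ (f j)) (fun j U => normMatY b (lamInvY (f j).toKIdx) (T (f j) U)))
    (hco₁ : CoerciveUnder c35 (fun j : J => geoComap (geo9Y (f j)) (Prod.fst : (geo9Y (f j)).Site × Ff → (geo9Y (f j)).Site))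
      (fun j : J => bg9YR 𝔸 G R₁ R₂ (f j)) (fun j U => normMatY b (lamInvY (f j).toKIdx) (T₁ (f j) U)))
    (hdec₁ : DecayUnder c35 (fun j : J => geoComap (geo9Y (f j)) (Prod.fst : (geo9Y (f j)).Site × Ff → (geo9Y (f j)).Site))
      (fun j : J => bg9YR 𝔸 G R₁ R₂ (f j)) (fun j U => normMatY b (lamInvY (f j).toKIdx) (T₁ (f j) U))) :
    B9.Stmt3132Printed dd c35 (fun j : J => geo9Y (f j)) (fun j : J => bg9YR 𝔸 G R₁ R₂ (f j))
      (fun j => siteKernelOfOpNu (f j).toKIdx (bg9YR 𝔸 G R₁ R₂ (f j)) (fun U => U) (nuY dd (f j).toKIdx) (fun U => Ring.inverse (T (f j) U)))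
      (fun j => siteKernelOfOpNu (f j).toKIdx (bg9YR 𝔸 G R₁ R₂ (f j)) (fun U => U) (nuY dd (f j).toKIdx) (fun U => Ring.inverse (T₁ (f j) U))) := by
  have hF : ∀ (j : J) (y : (geo9Y (f j)).Site),
      (((Finset.univ.filter fun a : (geo9Y (f j)).Site × Ff => a.1 = y).card : ℕ) : ℝ) ≤ (Fintype.card Ff : ℝ) :=
    fun j y => by rw [card_fiber_fst]
  have hνw : ∀ x : MemberY d ℓ hd hL b₀ b₁ Mstar,
      (fun y => nuY dd x.toKIdx y * lamInvY x.toKIdx y) = fun y => (geo9Y x).len y ^ (-(1 + (dd : ℝ) / 2)) :=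
    fun x => funext fun y => nuY_mul_lamInvY dd x.toKIdx y
  have hN : ∀ j : J,
      InvNormalisedIdx (g := geo9Y (f j))
        (siteKernelOfOpNu (f j).toKIdx (bg9YR 𝔸 G R₁ R₂ (f j)) (fun U => U) (nuY dd (f j).toKIdx) (fun U => Ring.inverse (T (f j) U)))
        (Prod.fst : (geo9Y (f j)).Site × Ff → (geo9Y (f j)).Site)
        (fun U => normMatY b (lamInvY (f j).toKIdx) (T (f j) U)) (fun y => (geo9Y (f j)).len y ^ (-(1 + (dd : ℝ) / 2))) := fun j => by
    rw [← hνw (f j)]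
    exact invNormalisedIdx_nu_of_ringInverse b (f j).toKIdx (bg9YR 𝔸 G R₁ R₂ (f j)) (fun U => U)
      (instF := (inferInstance : Fintype (geo9Y (f j)).Site)) (instD := (inferInstance : DecidableEq (geo9Y (f j)).Site)) (T (f j))
      (lamInvY_pos (f j).toKIdx) (fun y => (nuY_pos dd (f j).toKIdx y).le)
  have hN₁ : ∀ j : J,
      InvNormalisedIdx (g := geo9Y (f j))
        (siteKernelOfOpNu (f j).toKIdx (bg9YR 𝔸 G R₁ R₂ (f j)) (fun U => U) (nuY dd (f j).toKIdx) (fun U => Ring.inverse (T₁ (f j) U)))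
        (Prod.fst : (geo9Y (f j)).Site × Ff → (geo9Y (f j)).Site)
        (fun U => normMatY b (lamInvY (f j).toKIdx) (T₁ (f j) U)) (fun y => (geo9Y (f j)).len y ^ (-(1 + (dd : ℝ) / 2))) := fun j => by
    rw [← hνw (f j)]
    exact invNormalisedIdx_nu_of_ringInverse b (f j).toKIdx (bg9YR 𝔸 G R₁ R₂ (f j)) (fun U => U)
      (instF := (inferInstance : Fintype (geo9Y (f j)).Site)) (instD := (inferInstance : DecidableEq (geo9Y (f j)).Site)) (T₁ (f j))
      (lamInvY_pos (f j).toKIdx) (fun y => (nuY_pos dd (f j).toKIdx y).le)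
  exact stmt3132Printed_geo9Y_of_coercive_decay_idx_J f dd (fun j => (Prod.fst : (geo9Y (f j)).Site × Ff → (geo9Y (f j)).Site)) hF
    hco hdec hco₁ hdec₁ hN hN₁

end Row26

end Literature.MathematicalPhysics.QuantumFieldTheory.Balaban1983to89.B9Eq3132NuReadingRJ

end
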